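import Summits.QuantumAdvantage.QuantumAdvantage.Theorems.NearExactIsExact.Negative.SkewProductCore
import Summits.QuantumAdvantage.QuantumAdvantage.Theorems.NearExactIsExact.Negative.CentroidMoments

/-!
# `NearExactIsExact` (stmt-QuantumAdvantage-14043) — negative-side tool: Reed–Muller DUALITY on the cube and on a flat

The second half of the "product test ⇒ degree bound" step used by every structural statement about the
Maiorana–McFarland 31/32 habitat BQ-s of the crux (b2b cell, DISPROOF §10.4(b), §24.4, §24.8, §27): the
product test (`Negative.ProductTest`) gives PARITIES `Σ_{y ∈ U} P(y) G(y) ≡ 0` for all `P` of degree `≤ d`;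
Reed–Muller duality turns them into the DEGREE BOUND `deg G|_U ≤ dim U − 1 − d`. Kernel-checked here:

* `ind_eq_sum_prod_anf`: the algebraic normal form of a Boolean function on `𝔽₂^m`
  (`g(x) = Σ_S a_S(g) x^S`, `a_S(g) = Σ_{x ⊆ S} g(x)`, by Möbius inversion `sum_powerset_sum_powerset`);
* `anf_eq_zero`: if `#{x : p(x) ∧ g(x)}` is even for every `p` of degree `≤ d`, then `a_S(g) = 0` whenever
  `|S| ≥ m − d` (test `p = Π_{i ∉ S} (1 ⊕ x_i)`, of degree `m − |S| ≤ d`);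
* `isDegLeFun_of_orthogonal` (**RM duality**, `RM(d,m)^⊥ = RM(m−1−d,m)`, the inclusion `⊆`): under the same
  hypothesis `deg g ≤ k` as soon as `m ≤ d + k + 1`;
* `isDegLeFun_restrict_of_orthogonal`: the same ON A FLAT `U = e(𝔽₂^m) ⊆ 𝔽₂ˢ` given with an affine retraction
  `ρ` (`ρ ∘ e = id`; every flat has one): parities `#{y ∈ U : P(y) ∧ G(y)}` even for all `P` of degree `≤ d`
  on `𝔽₂ˢ` give `deg (G ∘ e) ≤ k`.

With `Negative.ProductTest` this yields hypotheses (V1), (V3), (V4) of LEMMA S13 (DISPROOF §27.2) formally.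
HONEST FRAMING: infrastructure for THEOREMS about one habitat of the crux, NOT summit progress.
Sources (orientation only): F. J. MacWilliams, N. J. A. Sloane, The Theory of Error-Correcting Codes (1977),
Ch. 13 §§3–4 (ANF / duals of Reed–Muller codes); everything is proved here from the tree; standard axioms.
-/

set_option linter.dupNamespace false -- D-0017: single-problem summit ⇒ `QuantumAdvantage.QuantumAdvantage` by design

namespace Summit.QuantumAdvantage.QuantumAdvantage.Theorems.NearExactIsExact.Negative.RMDual

open Finset
open Literature.Computability.QuantumComplexity
open Summit.QuantumAdvantage.QuantumAdvantage.Theorems.CubicForrelation.NearExactIsExact (fc_isDegLeFun_comp)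
open Summit.QuantumAdvantage.QuantumAdvantage.Theorems.NearExactIsExact.Negative.SkewProductCore
  (ind ind_true ind_false ind_and decide_ind_eq_one indic supp indic_supp prod_ind_eq sum_powerset_supp
    sum_powerset_sum_powerset isDegLeFun_sum isDegLeFun_prod sum_ind)
open Summit.QuantumAdvantage.QuantumAdvantage.Theorems.NearExactIsExact.Negative.CentroidMoments (isDegLeFun_not)

variable {m : ℕ}

/-! ### The algebraic normal form -/

/-! Throughout, the ANF coefficient `a_S(g) = Σ_{x ⊆ S} g(x) ∈ 𝔽₂` is written out as
`∑ J ∈ S.powerset, ind (g (indic J))` (no new definition, so that this file stays a pure-proof module). -/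

/-- `supp (indic J) = J`. [folklore] -/
theorem supp_indic (J : Finset (Fin m)) : supp (indic J) = J := by
  ext j
  simp [supp, indic]

/-- Möbius inversion: `g(x) = Σ_{S ⊆ supp x} a_S(g)`. [folklore] -/
theorem ind_eq_sum_anf (g : (Fin m → Bool) → Bool) (x : Fin m → Bool) :
    ind (g x) = ∑ S ∈ (supp x).powerset, (∑ J ∈ S.powerset, ind (g (indic J))) := by
  rw [sum_powerset_sum_powerset (fun J => ind (g (indic J))) (supp x), indic_supp]

/-- The ANF expansion `g(x) = Σ_S x^S · a_S(g)`. [folklore] -/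
theorem ind_eq_sum_prod_anf (g : (Fin m → Bool) → Bool) (x : Fin m → Bool) :
    ind (g x) = ∑ S, (∏ k ∈ S, ind (x k)) * (∑ J ∈ S.powerset, ind (g (indic J))) := by
  rw [ind_eq_sum_anf, sum_powerset_supp]

/-- The ANF coefficient as a count: `a_S(g) ≡ #{x : supp x ⊆ S, g(x) = 1} (mod 2)`. [folklore] -/
theorem anf_eq_card (g : (Fin m → Bool) → Bool) (S : Finset (Fin m)) :
    (∑ J ∈ S.powerset, ind (g (indic J))) = ((#(univ.filter fun x : Fin m → Bool => (decide (supp x ⊆ S) && g x) = true) : ℕ) : ZMod 2) := by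
  rw [← sum_ind]
  have e : ∀ x : Fin m → Bool, ind (decide (supp x ⊆ S) && g x) = if supp x ⊆ S then ind (g x) else 0 := by
    intro x
    by_cases h : supp x ⊆ S <;> simp [h, ind]
  simp_rw [e]
  rw [← sum_filter]
  refine sum_nbij' indic supp ?_ ?_ ?_ ?_ ?_
  · intro J hJ
    rw [mem_filter, supp_indic]
    exact ⟨mem_univ _, mem_powerset.mp hJ⟩
  · intro x hx
    exact mem_powerset.mpr (mem_filter.mp hx).2
  · intro J _
    exact supp_indic J
  · intro x _
    exact indic_supp x
  · intro J _
    rfl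

/-! ### Orthogonality to `RM(d)` kills the high coefficients -/

/-- The cylinder indicator `[supp x ⊆ S] = Π_{i ∉ S} (1 ⊕ x_i)` has degree `≤ m − |S|`. [folklore] -/
theorem isDegLeFun_cylinder (S : Finset (Fin m)) :
    IsDegLeFun (m - #S) (fun x : Fin m → Bool => decide (supp x ⊆ S)) := by
  have e : (fun x : Fin m → Bool => decide (supp x ⊆ S)) =
      fun x => decide ((∏ i ∈ univ \ S, ind (!x i)) = 1) := by
    funext x
    rw [prod_ind_eq (fun i => !x i) (univ \ S)]
    have hiff : univ \ S ⊆ supp (fun i => !x i) ↔ supp x ⊆ S := by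
      simp only [supp, subset_iff, mem_sdiff, mem_univ, true_and, mem_filter, Bool.not_eq_true']
      constructor
      · intro h j hj
        by_contra hjS
        have := h hjS
        rw [hj] at this
        exact Bool.noConfusion this
      · intro h j hjS
        cases hxj : x j
        · rfl
        · exact absurd (h hxj) hjS
    by_cases h : supp x ⊆ S
    · rw [if_pos (hiff.mpr h)]
      simp [h]
    · rw [if_neg (fun h' => h (hiff.mp h'))]
      simp [h]
  rw [e]
  have h := isDegLeFun_prod (fun i (x : Fin m → Bool) => !x i) (univ \ S)
    (fun i _ => isDegLeFun_not (isDegLeFun_apply i le_rfl))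
  rw [card_univ_sdiff, Fintype.card_fin, one_mul] at h
  exact h

/-- If `#{x : p(x) ∧ g(x)}` is even for every `p` of degree `≤ d`, the ANF coefficients `a_S(g)` with
`|S| ≥ m − d` vanish. [folklore] -/
theorem anf_eq_zero {g : (Fin m → Bool) → Bool} {d : ℕ}
    (h : ∀ p : (Fin m → Bool) → Bool, IsDegLeFun d p →
      Even #(univ.filter fun x : Fin m → Bool => (p x && g x) = true))
    {S : Finset (Fin m)} (hS : m ≤ d + #S) : (∑ J ∈ S.powerset, ind (g (indic J))) = 0 := by
  rw [anf_eq_card]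
  exact (ZMod.natCast_eq_zero_iff_even).2 (h _ ((isDegLeFun_cylinder S).mono (by omega)))

/-! ### Reed–Muller duality -/

/-- **RM duality** (`RM(d,m)^⊥ ⊆ RM(m−1−d,m)`): if `#{x : p(x) ∧ g(x)}` is even for every `p` of degree
`≤ d`, then `g` has degree `≤ k` whenever `m ≤ d + k + 1`. [folklore] -/
theorem isDegLeFun_of_orthogonal {g : (Fin m → Bool) → Bool} {d k : ℕ} (hk : m ≤ d + k + 1)
    (h : ∀ p : (Fin m → Bool) → Bool, IsDegLeFun d p →
      Even #(univ.filter fun x : Fin m → Bool => (p x && g x) = true)) :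
    IsDegLeFun k g := by
  have e : g = fun x => decide ((∑ S ∈ univ.filter (fun S : Finset (Fin m) => #S ≤ k),
      (∏ i ∈ S, ind (x i)) * (∑ J ∈ S.powerset, ind (g (indic J)))) = 1) := by
    funext x
    have h1 : ind (g x) = ∑ S ∈ univ.filter (fun S : Finset (Fin m) => #S ≤ k),
        (∏ i ∈ S, ind (x i)) * (∑ J ∈ S.powerset, ind (g (indic J))) := by
      rw [ind_eq_sum_prod_anf, ← sum_filter_add_sum_filter_not univ (fun S : Finset (Fin m) => #S ≤ k)]
      have h0 : ∑ S ∈ univ.filter (fun S : Finset (Fin m) => ¬ #S ≤ k),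
          (∏ i ∈ S, ind (x i)) * (∑ J ∈ S.powerset, ind (g (indic J))) = 0 :=
        sum_eq_zero fun S hS => by
          rw [anf_eq_zero h (by have := (mem_filter.mp hS).2; omega), mul_zero]
      rw [h0, add_zero]
    rw [← h1, decide_ind_eq_one]
  rw [e]
  refine isDegLeFun_sum (fun (S : Finset (Fin m)) (x : Fin m → Bool) => (∏ i ∈ S, ind (x i)) * (∑ J ∈ S.powerset, ind (g (indic J)))) _
    fun S hS => ?_
  have hSk : #S ≤ k := (mem_filter.mp hS).2
  rcases (by decide : ∀ a : ZMod 2, a = 0 ∨ a = 1) ((∑ J ∈ S.powerset, ind (g (indic J)))) with h0 | h1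
  · have e0 : (fun x : Fin m → Bool => decide ((∏ i ∈ S, ind (x i)) * (∑ J ∈ S.powerset, ind (g (indic J))) = 1)) = fun _ => false := by
      funext x
      rw [h0, mul_zero]
      decide
    rw [e0]
    exact isDegLeFun_const k false
  · simp_rw [h1, mul_one]
    exact (isDegLeFun_prod (fun i (x : Fin m → Bool) => x i) S
      (fun i _ => isDegLeFun_apply i le_rfl)).mono (by omega)

/-- **RM duality on a flat.** Let `U ⊆ 𝔽₂ˢ` be the image of `e : 𝔽₂^m → 𝔽₂ˢ` with a coordinatewise-affine
retraction `ρ` (`ρ (e u) = u`; every injective affine `e` has one). If `#{y ∈ U : P(y) ∧ G(y)}` is even for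
every `P` of degree `≤ d` on `𝔽₂ˢ`, then `G ∘ e` has degree `≤ k` whenever `m ≤ d + k + 1`
(test `P = p ∘ ρ` and transport the count along `e`). [folklore] -/
theorem isDegLeFun_restrict_of_orthogonal {s d k : ℕ} (hk : m ≤ d + k + 1)
    (e : (Fin m → Bool) → (Fin s → Bool)) (ρ : (Fin s → Bool) → (Fin m → Bool))
    (hρ : ∀ j, IsDegLeFun 1 (fun y => ρ y j)) (hρe : ∀ u, ρ (e u) = u)
    (U G : (Fin s → Bool) → Bool) (hU : ∀ y, U y = true ↔ ∃ u, e u = y)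
    (h : ∀ P : (Fin s → Bool) → Bool, IsDegLeFun d P →
      Even #(univ.filter fun y : Fin s → Bool => (U y && (P y && G y)) = true)) :
    IsDegLeFun k (fun u => G (e u)) := by
  refine isDegLeFun_of_orthogonal hk fun p hp => ?_
  have hP : IsDegLeFun d (fun y : Fin s → Bool => p (ρ y)) := fc_isDegLeFun_comp hp ρ hρ (by omega)
  have hc : #(univ.filter fun u : Fin m → Bool => (p u && G (e u)) = true) =
      #(univ.filter fun y : Fin s → Bool => (U y && (p (ρ y) && G y)) = true) := by
    refine card_nbij' e ρ ?_ ?_ ?_ ?_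
    · intro u hu
      rw [mem_coe, mem_filter] at hu ⊢
      refine ⟨mem_univ _, ?_⟩
      rw [(hU (e u)).2 ⟨u, rfl⟩, hρe]
      exact hu.2
    · intro y hy
      rw [mem_coe, mem_filter] at hy ⊢
      refine ⟨mem_univ _, ?_⟩
      have hUy : U y = true := by
        have := hy.2
        revert this
        cases U y <;> simp
      obtain ⟨u, rfl⟩ := (hU _).1 hUy
      have := hy.2
      rw [hρe] at this ⊢
      revert this
      cases p u <;> cases G (e u) <;> simp
    · intro u _
      exact hρe u
    · intro y hy
      rw [mem_coe, mem_filter] at hy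
      have hUy : U y = true := by
        have := hy.2
        revert this
        cases U y <;> simp
      obtain ⟨u, rfl⟩ := (hU _).1 hUy
      rw [hρe]
  rw [hc]
  exact h _ hP

end Summit.QuantumAdvantage.QuantumAdvantage.Theorems.NearExactIsExact.Negative.RMDual
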